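import Summits.BirchSwinnertonDyer.Rank1Residual.Partition.MainConjecturesEisensteinTwistCertificate
import Literature.NumberTheory.EllipticCurves.Wuthrich2014.ShaBoundProofs
import Literature.NumberTheory.EllipticCurves.AnalyticRankOrderProofs
import HarnessLib

/-!
# Row D4 ∩ {r = 1}: the twist-certificate road in ISOGENY-CLASS form (certificate read on an
# isogenous member, conclusion on the census record)

HONEST FRAMING (cell `bsd-litref`, programme `BSD-LIT2PART-PROGRAMME-v1.md` §T2d, verbatim): "no
tranche here proves BSD; ARM L moves the LITERAL column of an r ≤ 1 census into the kernel-proved-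
modulo-named-print column". `Proofs`-style Summits file: THEOREMS ONLY. Seat `bsd-litref-cgs25-pv`.

## Why

Referee A ROUND 346 booked row T-CGLS55-TW (`RowC6.bsdp_rankOne_of_display55_of_twistShaAnUnit`,
p455255): per class `(E, p)` of analytic rank one a Heegner field `K = ℚ(√D)` with `ord_p #Ш_an(E^D) = 0`.
Three @3 classes (167024k1, 249392n1, 308294k1; A 346.6 (b)) and 433136t1 resist: EVERY admissible `D`
tried gives `3 ∣ #Ш_an(E^D)` — the classes carry a cyclic `9`- (resp. `3`-) isogeny and the record curve
is the member on which the twist's `Ш_an` absorbs the isogeny factor. A 346.6 (b): «re-offerable at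
larger |D| or isogenous shape». This file is the kernel side of the ISOGENOUS SHAPE: the certificate
is READ ON AN ISOGENOUS CURVE `W'` (another member of the class) and `BSDp` is TRANSPORTED to the
census record `W` by Cassels' isogeny invariance of the BSD quotient (`bsdRHS_eq_of_isIsogenous`,
Milne ADT I.7.3, through `Wuthrich2014.bsdp_of_isIsogenous`), with `Ш(W')` finite from GZK at analytic
rank `1` and `L'(W',1) ≠ 0` as the leading coefficient (modularity, from `hnf`). The rank-one road has
no Manin binder, so no optimality record is involved.

* `RowC6.isogenous_bsdp_rankOne_of_display55_of_twistShaAnUnit` — `W ∼ W'` (`ℚ`-isogenous, both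
  globally minimal); on `W'`: `p > 2` good, `W'[p]` reducible, `a_p ≢ 1 (mod p)`, `ord_{s=1}L(W',s) = 1`,
  `K` imaginary quadratic with `d_K` odd `< −4`, Heegner for `N_{W'}` and `p`, `L(W'^{(d_K)},1) ≠ 0`, a
  globally minimal model `Wd` of `W'^{(d_K)}` with `ord_p #Ш_an(Wd) = 0` ⇒ `BSDp W p`. Named facts: those
  of p455255 (A157 display (5.5), C14, modularity ×2, Gross–Zagier ×2, Kolyvagin, GZK) + Cassels.

References: [CastellaGrossiLeeSkinner2022] proof of Thm. 5.3.1, (5.5)–(5.7); [MilneADT2006] Thm. I.7.3,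
Rem. I.7.4; [Miller2011LMS] §1, Def. 1.1; referee A ROUND 346, 346.6 (b) (pub/pub-bsdpct/REFEREE.md).
-/

set_option autoImplicit false

noncomputable section

open scoped Classical

open WeierstrassCurve NumberField Literature.NumberTheory.EllipticCurves
  Literature.NumberTheory.EllipticCurves.ModularForms Literature.NumberTheory.QuadraticFields
  Literature.NumberTheory.EllipticCurves.Rank1Residual
  Literature.NumberTheory.EllipticCurves.CastellaGrossiLeeSkinner2022

namespace Summit.BirchSwinnertonDyer.Rank1Residual

/-- **Row D4 ∩ {r = 1}, isogeny-class form of the twist-certificate door (row T-CGLS55-TW).**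
`W ∼ W'` over `ℚ` (both globally minimal elliptic); on `W'`: `p > 2` good, `W'[p]` reducible,
`a_p ≢ 1 (mod p)`, `ord_{s=1}L(W',s) = 1`; `K` imaginary quadratic, `d_K` odd `< −4`, every prime of
`N_{W'}` split, `p` split, `L(W'^{(d_K)},1) ≠ 0`; `Wd` a globally minimal model of `W'^{(d_K)}` with
`ord_p #Ш_an(Wd) = 0`. Then `BSDp W p`. Proof: `RowC6.bsdp_rankOne_of_display55_of_twistShaAnUnit` on
`W'`, then Cassels' isogeny invariance (`Wuthrich2014.bsdp_of_isIsogenous`, `hCassels`) with `Ш(W')`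
finite (GZK at analytic rank `1`) and `L'(W',1) ≠ 0` as leading coefficient (modularity from `hnf`,
`leadingLCoeff_ne_zero_holds`). [cite: CastellaGrossiLeeSkinner2022, proof of Thm. 5.3.1, (5.5)–(5.7)]
[cite: MilneADT2006, Thm. I.7.3 and Remark I.7.4] [cite: Miller2011LMS, §1 and Def. 1.1] -/
theorem RowC6.isogenous_bsdp_rankOne_of_display55_of_twistShaAnUnit
    (hCassels : bsdRHS_eq_of_isIsogenous) (h55 : display55_sha_heegnerIndex)
    (hW : Wuthrich2014.sha_dvd_analyticSha)
    (hmodP : nonempty_modularParametrizationData) (hnf : exists_isNewformOf)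
    (hGZQ : GrossZagier1986_thm_I_7_3)
    (hGZ : ∀ (N : ℕ) [NeZero N] (W : WeierstrassCurve ℚ) (K : Type) [Field K] [NumberField K],
      gross_zagier N W K)
    (hKo : ∀ (N : ℕ) [NeZero N] (W : WeierstrassCurve ℚ) (K : Type) [Field K] [NumberField K],
      kolyvagin N W K)
    (hGZK : rank_eq_analyticRank_of_analyticRank_le_one)
    (W : WeierstrassCurve ℚ) [W.IsElliptic] [W.IsGloballyMinimal]
    (W' : WeierstrassCurve ℚ) [W'.IsElliptic] [W'.IsGloballyMinimal] (hiso : IsIsogenous W W')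
    (p : ℕ) [Fact p.Prime] (hp : 2 < p) (hgood : Good W' p) (hred : Red W' p) (hna : ¬ Anom W' p)
    (hr : W'.analyticRank = 1)
    (K : Type) [Field K] [NumberField K] (hK : IsImaginaryQuadratic K)
    (hodd : Odd (NumberField.discr K)) (hlt : NumberField.discr K < -4)
    (hHN : SatisfiesHeegnerHypothesis (W'.conductorNorm ℤ) K) (hHp : SatisfiesHeegnerHypothesis p K)
    (hLt : (W'.quadraticTwist (NumberField.discr K : ℚ)).entireLFunction 1 ≠ 0)
    (Wd : WeierstrassCurve ℚ) [Wd.IsElliptic] [Wd.IsGloballyMinimal]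
    (hWd : ∃ C : VariableChange ℚ, C • Wd = W'.quadraticTwist (NumberField.discr K : ℚ))
    (hunit : ∃ q : ℚ, shaAn Wd = (q : ℂ) ∧ padicValRat p q = 0) : BSDp W p :=
  Wuthrich2014.bsdp_of_isIsogenous hCassels hiso (hGZK W' (by omega)).2
    (W'.leadingLCoeff_ne_zero_holds (hasEntireLFunction_rat_of_exists_isNewformOf hnf W'))
    (RowC6.bsdp_rankOne_of_display55_of_twistShaAnUnit h55 hW hmodP hnf hGZQ hGZ hKo hGZK W' p hp hgood
      hred hna hr K hK hodd hlt hHN hHp hLt Wd hWd hunit)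

end Summit.BirchSwinnertonDyer.Rank1Residual

end
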